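import Literature.AlgebraicGeometry.Resolution.RegularLocalRingsNormal
import HarnessLib

/-!
# The `𝔪`-adic order in a regular local ring is additive: `ord(ab) = ord a + ord b`

Topic: `Literature/AlgebraicGeometry/Resolution`. A brick for the order function
`ord_x` of the resolution algorithm (BGMW 2011 §3.1; `idealOrder`, `MarkedIdeals.lean`): at a
regular point the order is a valuation-like function — the reverse inclusions of BGMW
Lemma 3.7.1 and Example 3.4.2 (`supp(𝓘, μ) = supp(𝓘ᵏ, kμ)`) rest on `ord_x(fᵏ) = k · ord_x(f)`.
PROVED from Matsumura Thm. 17.10 (`gr_𝔪(A) ≅ k[X_1, …, X_d]` is a domain; initial forms: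
`RegularLocalRingsNormal.lean`, Zariski–Samuel VIII §1 Thm. 1: "`v(ab) = v(a) + v(b)`"):

* `mul_not_mem_pow_of_not_mem_pow` — **`a ∉ 𝔪ᵖ⁺¹`, `b ∉ 𝔪^{q+1}` ⇒ `ab ∉ 𝔪^{p+q+1}`** in a
  regular local ring (with `𝔪ᵖ 𝔪^q ⊆ 𝔪^{p+q}`: `ord(ab) = ord a + ord b`);
* `pow_not_mem_pow_of_not_mem_pow` — `a ∉ 𝔪ᵖ⁺¹ ⇒ aᵉ ∉ 𝔪^{ep+1}`;
* `Ideal.le_pow_of_pow_le_pow_mul` — **`𝓘ᵉ ⊆ 𝔪^{ep}` ⇒ `𝓘 ⊆ 𝔪ᵖ`** (`e ≥ 1`): the ring form at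
  a regular point of BGMW Example 3.4.2 / the reverse inclusion in Lemma 3.7.1 (1).

## Sources

* O. Zariski, P. Samuel, *Commutative Algebra* II (1960), Ch. VIII §1, Thm. 1 (order function of
  a regular local ring). [ZariskiSamuel1960]
* H. Matsumura, *Commutative Ring Theory* (1986), Thm. 17.10. [Matsumura1987]
* E. Bierstone, D. Grigoriev, P. Milman, J. Włodarczyk, arXiv:1206.3090, §3.1, Example 3.4.2,
  Lemma 3.7.1 — the application. [BierstoneGrigorievMilmanWlodarczyk2011]
-/

namespace Literature.AlgebraicGeometry.Resolution

universe u

open IsLocalRing MvPolynomial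

variable {R : Type u} [CommRing R] [IsRegularLocalRing R]

/-- **The order is additive in a regular local ring** (Zariski–Samuel VIII §1 Thm. 1:
`v(ab) = v(a) + v(b)`, via Matsumura Thm. 17.10: the product of the initial forms of `a` and `b`
in the domain `k[X_1, …, X_d] = gr_𝔪(A)` is nonzero): if `a ∉ 𝔪ᵖ⁺¹` and `b ∉ 𝔪^{q+1}` then
`ab ∉ 𝔪^{p+q+1}`. [cite: ZariskiSamuel1960, Ch. VIII §1 Thm. 1] -/
theorem mul_not_mem_pow_of_not_mem_pow {a b : R} {p q : ℕ} (ha : a ∉ maximalIdeal R ^ (p + 1))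
    (hb : b ∉ maximalIdeal R ^ (q + 1)) : a * b ∉ maximalIdeal R ^ (p + q + 1) := by
  classical
  haveI := isDomain_of_isRegularLocalRing R
  have ha0 : a ≠ 0 := by rintro rfl; exact ha (zero_mem _)
  have hb0 : b ≠ 0 := by rintro rfl; exact hb (zero_mem _)
  -- a regular system of parameters `x : Fin d → R`
  obtain ⟨x, hx⟩ := exists_regularSystemOfParameters (R := R)
  generalize hd : (maximalIdeal R).spanFinrank = d at x hx
  -- initial forms of `a` and `b`
  obtain ⟨m, F, hF, hFa, hF0⟩ := exists_isHomogeneous_eval_eq_map_ne_zero x hx ha0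
  obtain ⟨n, G, hG, hGb, hG0⟩ := exists_isHomogeneous_eval_eq_map_ne_zero x hx hb0
  -- their degrees are the orders: `m ≤ p`, `n ≤ q`
  have hFm : eval x F ∈ maximalIdeal R ^ m := hx ▸ eval_mem_span_pow x hF
  have hGn : eval x G ∈ maximalIdeal R ^ n := hx ▸ eval_mem_span_pow x hG
  have hm : m ≤ p := by
    by_contra h
    refine ha (Ideal.pow_le_pow_right (show p + 1 ≤ m by omega) ?_)
    rw [← hFa]
    exact hFm
  have hn : n ≤ q := by
    by_contra h
    refine hb (Ideal.pow_le_pow_right (show q + 1 ≤ n by omega) ?_)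
    rw [← hGb]
    exact hGn
  -- the product form has nonzero reduction (`k[X]` is a domain) and value `ab`
  have hFG : (F * G).IsHomogeneous (m + n) := hF.mul hG
  have hFG0 : map (residue R) (F * G) ≠ 0 := by
    rw [map_mul]
    exact mul_ne_zero hF0 hG0
  intro hab
  have hab' : eval x (F * G) ∈ maximalIdeal R ^ (p + q + 1) := by
    rwa [map_mul, hFa, hGb]
  have := le_of_eval_mem_pow hd x hx hFG hFG0 hab'
  omega

/-- Powers: `a ∉ 𝔪ᵖ⁺¹ ⇒ aᵉ ∉ 𝔪^{ep+1}` (`ord(aᵉ) = e · ord a`).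
[cite: ZariskiSamuel1960, Ch. VIII §1 Thm. 1] -/
theorem pow_not_mem_pow_of_not_mem_pow {a : R} {p : ℕ} (ha : a ∉ maximalIdeal R ^ (p + 1)) :
    ∀ e : ℕ, a ^ e ∉ maximalIdeal R ^ (e * p + 1) := by
  intro e
  induction e with
  | zero =>
    rw [pow_zero, zero_mul, zero_add, pow_one]
    exact fun h => (maximalIdeal.isMaximal R).ne_top (Ideal.eq_top_of_isUnit_mem _ h isUnit_one)
  | succ e ih =>
    rw [pow_succ a e, show (e + 1) * p + 1 = e * p + p + 1 by ring]
    exact mul_not_mem_pow_of_not_mem_pow ih ha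

/-- **`𝓘ᵉ ⊆ 𝔪^{ep}` implies `𝓘 ⊆ 𝔪ᵖ`** for `e ≥ 1` in a regular local ring — the ring form at
a regular point of BGMW Example 3.4.2 (`(𝓘, μ) ≃ (𝓘ᵏ, kμ)`: `supp(𝓘ᵏ, kμ) ⊆ supp(𝓘, μ)`) and of
the reverse inclusion in Lemma 3.7.1 (1). [cite: BierstoneGrigorievMilmanWlodarczyk2011, Example 3.4.2] -/
theorem Ideal.le_pow_of_pow_le_pow_mul {I : Ideal R} {e p : ℕ} (he : 0 < e)
    (h : I ^ e ≤ maximalIdeal R ^ (e * p)) : I ≤ maximalIdeal R ^ p := by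
  intro a ha
  by_contra hna
  cases p with
  | zero => exact hna (by rw [pow_zero, Ideal.one_eq_top]; exact Submodule.mem_top)
  | succ p' =>
    have h1 := pow_not_mem_pow_of_not_mem_pow hna e
    refine h1 (Ideal.pow_le_pow_right ?_ (h (Ideal.pow_mem_pow ha e)))
    -- `e p' + 1 ≤ e (p' + 1)` since `e ≥ 1`
    nlinarith

/-- Symmetric form: in a regular local ring, `𝓘ᵉ ⊆ 𝔪^{ep} ↔ 𝓘 ⊆ 𝔪ᵖ` for `e ≥ 1`
(`supp(𝓘ᵉ, eμ) = supp(𝓘, μ)`, BGMW Example 3.4.2, at a regular point).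
[cite: BierstoneGrigorievMilmanWlodarczyk2011, Example 3.4.2] -/
theorem Ideal.pow_le_pow_mul_iff {I : Ideal R} {e p : ℕ} (he : 0 < e) :
    I ^ e ≤ maximalIdeal R ^ (e * p) ↔ I ≤ maximalIdeal R ^ p :=
  ⟨Ideal.le_pow_of_pow_le_pow_mul he, fun h => by rw [pow_mul']; exact Ideal.pow_right_mono h e⟩

end Literature.AlgebraicGeometry.Resolution
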